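import Summits.QuantumFields.BalabanUV.T4Continuum.Support.NE7ApeTrivialFlatEndSkew
import Summits.QuantumFields.BalabanUV.T4Continuum.Support.NE7QbarLipschitzBudget
import HarnessLib

/-!
# NE7ApeTrivialFlatEndSkewBudget — THE (APE) BOOTSTRAP AT THE TRIVIAL FLAT DATUM, FULLY EXPLICIT, WITH `G♭` ON THE SKEW SLICE: F55a `NE7ApeTrivialFlatEndSkew` with
# the straight-tower letter `Λ` DISCHARGED by F51 `NE7QbarLipschitzBudget`, and the result in F31's `M⁻²` currency (the desk's RETURN R-END75-ne7ref-2 on F54b)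

Cell `pub-balaban`, rung (B)+1 sub-cell t4, lineage `b2b-balaban-t4-ne7-p1`, generation 72 (CRUX PROVER NE7 #1); memos H14 (gen 70), H15 §3, §7.  File F55b — F54b
`NE7ApeTrivialFlatEndBudget` (p391168) re-issued over F55a: F54b's slice solver binder `hG : ∀ X, IsPeriodicDir X P → …` (over ALL complex `X`) is UNSATISFIABLE for
`d ≥ 1` (NE7 pricing desk E-62-1 ∕ E-75-6, kernel witness `b2b-balaban-t4-ne7-refuter/g75/probe/ENDp390283Vacuity.lean` `hG_F54b_l146_false`), so F54b is VACUOUS AS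
TYPED at its G♭ slot; here the binder reads `∀ X, IsSkewDir X → IsPeriodicDir X P → …` (repair R1; R1b is inside F55a via p2's `NE7FlatSkewSlice`).  Proofs: F54b's
verbatim, calling F55a `smallField_of_trivialLetters_gauge_skew` in place of F54a; F51 (`sum_norm_QbarIter_vary_flat_sub_le`, the letter `Λ` at `e^{A}` under the budget
lines `C_S·α̂ ≤ 1`, `256(d+2)L(3+12(d+1))α̂ ≤ 1`), F38 `radius_currency`, F48b `rho_currency`, F54a `tau_currency_delta` unchanged.
WHY.  After this file, (APE) at the trivial flat datum is, as ONE kernel theorem with a SATISFIABLE solver hypothesis, exactly: REP♭ (B8 Thm 2 TYPE: gauge `u`,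
representative `A` with `‖A‖ ≤ α₀`, lattice differences `≤ α₁ ≤ α̂₁M⁻²`, TOP NORMALISATION `cavgIter (k+1) e^{A} = 1`) + G♭ on the skew slice ((1.115) 2nd entry TYPE,
constant `K·M`) + numeric smallness of `α̂ = Mα₀` and the class radius ⟹ `SmallField U ((K(τ̂ + ρ̂) + C_Rĝ + 28α̂²)·M⁻²)` — every `M = L^{k+1}` cancelled.
WHAT ([folklore]; 0 def, 0 sorry; dimension `d + 1`).  **`smallField_of_trivialLetters_explicit_skew`** (F55a's gauge form with `Λ` discharged by F51: `τ` explicit),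
**`smallField_of_trivialLetters_currency_skew`** (the same in F31's currency: radius `(K(τ̂ + ρ̂) + C_Rĝ + 28α̂²)∕M²`, `τ̂ = 2·(curl1C∕(1−θℓ))·C_S·δ·α̂`,
`ρ̂ = #Plane·(144α̂α̂₁ + 5440α̂³ + 8α̂₁² + 304α̂₁α̂² + 2688α̂⁴)`, `C_Rĝ = card n·C₃₇·ĝ(α̂)`) — LITERALLY F54b's radii.
HONEST FRAMING (page 1): a composition of tree theorems; REP♭ (incl. the top normalisation) and G♭ (on the skew slice) are HYPOTHESES (Bałaban TYPES, not proved
here); ONE datum (the trivial one), not F31's `hape` on the data class; (APE) NOT proved unconditionally; NOT ONE-STEP, NOT NE7; spine 0∕9; finite T⁴ rung (B)+1 —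
NOT infinite volume, NOT mass gap, NOT Clay.  Continuum YM on T⁴ ⇐ BetaPertH ∧ nine spine estimates (0/9 proved); BetaPertH ⇐ (D1) ∧ (D4) ∧ CAP+tail; G-an2-4
gates asym, D1 and NE2/3/4.
-/

set_option autoImplicit false

open scoped BigOperators Matrix.Norms.L2Operator
open NormedSpace Finset

namespace Summit.QuantumFields.BalabanUV.T4Continuum.NE7ApeTrivialFlatEndSkewBudget

open Literature.MathematicalPhysics.QuantumFieldTheory.Balaban1983to89
open B7Prop1Explicit B7Prop2Explicit MatrixLog UnitaryModel
open T4AveragingDeficitWall (IsUnitaryCfg IsSkewDir SmallField vary curlAt dirL1)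
open T4AveragingDeficitWallBoundary (IsPeriodicCfg periodBox)
open AveragingDeficitPeriodicCounting (IsPeriodicDir)
open AveragingDeficitMultiLevelPrep (cavgIter LevelSmall)
open MinimalActionLevels (perWin)
open MinimalActionRate (SmallField.mono)
open BlockAveragePushDirSplit (flat)
open BlockAverageVaryHolo (nbRad)
open BlockAverageVaryDisc (rho0)
open B4Sect5Proof (latticeConst)
open B5Hk163Strip (kappa163)
open B5Hk163TorusHolderDecay (CdecD)
open NE3HessForm (hess dAction)
open NE3TangentCovariantTower (dirIter QbarIter)
open NE3QbarIterCovLiftPrep (cruxC)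
open NE3RightInverseSolveLetters (thetaLoc)
open NE3HatInvCurlLetters (curl1C curl1C_nonneg)
open NE3LinearisedAverageSup (curvSum)
open NE3EnergyShapes (IsUnitarySite)
open NE7CoarseCurvatureLetter (levelSmall_zero curvSum_zero)
open NE7QbarLipschitzBudget (sum_norm_QbarIter_vary_flat_sub_le)
open NE7ApeFlatSkeleton (radius_currency)
open NE7ExpansionRemainderFlat (rho_currency)
open NE7ApeTrivialFlatEnd (tau_currency_delta)
open NE7ApeTrivialFlatEndSkew (smallField_of_trivialLetters_gauge_skew)

noncomputable section

variable {d : ℕ} {n : Type*} [Fintype n] [DecidableEq n]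

/-- **THE END, FULLY EXPLICIT, `G♭` ON THE SKEW SLICE**: F55a `smallField_of_trivialLetters_gauge_skew` with the tower letter supplied by F51
(`Λ = 2·C_S·α̂·(L∕L^{d+1})^{k+1}`, under F51's two budget lines on `α̂ = L^{k+1}α₀`).  Hypotheses as in F55a (U's class data and criticality, REP♭'s `u, A` with
currencies and top normalisation, σ-line, G♭ with the binder `IsSkewDir X →`); radius LITERALLY F54b's. [folklore] -/
theorem smallField_of_trivialLetters_explicit_skew [Nonempty n] {L N : ℕ} [NeZero N] (hL : 2 ≤ L) (k : ℕ)
    {U : Site (d + 1) → Fin (d + 1) → (Matrix n n ℂ)ˣ} (hU : IsUnitaryCfg U) {x a : ℝ} (hx : 0 ≤ x) (hs : LevelSmall (d + 1) L k x)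
    (hUx : SmallField U x) (ha : 0 ≤ a) (hUa : SmallField U a)
    (hcritU : ∀ φ : Site (d + 1) → Fin (d + 1) → Matrix n n ℂ, IsSkewDir φ → IsPeriodicDir φ ((L ^ (k + 1) * N : ℕ) : ℤ) →
      dirIter L (k + 1) U φ = 0 → dAction U φ (perWin (d + 1) (L ^ (k + 1) * N)) = 0)
    {u : Site (d + 1) → (Matrix n n ℂ)ˣ} (hu : IsUnitarySite u) (huP : ∀ (y : Site (d + 1)) (i : Fin (d + 1)), u (y + (((L ^ (k + 1) * N : ℕ) : ℤ)) • e i) = u y)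
    {A : Site (d + 1) → Fin (d + 1) → Matrix n n ℂ} (hgauge : gaugeAct u U = vary (flat (d := d + 1) (n := n)) A 1)
    (hA : IsSkewDir A) (hAP : IsPeriodicDir A ((L ^ (k + 1) * N : ℕ) : ℤ))
    {α₀ α₁ : ℝ} (hα₀ : 0 ≤ α₀) (hα₁ : 0 ≤ α₁) (hAα : ∀ (y : Site (d + 1)) (κ : Fin (d + 1)), ‖A y κ‖ ≤ α₀)
    (hA1 : ∀ (y : Site (d + 1)) (κ τ : Fin (d + 1)), ‖A (y + e τ) κ - A y κ‖ ≤ α₁)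
    (hθ : cruxC (d + 1) L * (((L : ℝ) ^ (k + 1)) ^ 2 * x) < 1) (hθl : thetaLoc (d + 1) L * (((L : ℝ) ^ (k + 1)) ^ 2 * x) < 1)
    (hε : ((L : ℝ) ^ (k + 1)) ^ 2 * x ≤ 1)
    (hσ : 4 * (3 + 12 * ((d + 1 : ℕ) : ℝ)) ^ 2 * (L : ℝ) ^ (k + 1) * α₀ ≤ rho0 (d + 1) L ^ 2)
    (hS1 : (8 * (3 + 12 * ((d + 1 : ℕ) : ℝ)) * (2 + 2 * ((((d + 1 : ℕ) : ℝ) + 1) * L)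
        * (1 + ((1250 * ((nbRad (d + 1) L : ℝ) + L) + 8 * (((d + 1 : ℕ) : ℝ) * L) + 2 * L) * (((d + 1 : ℕ) : ℝ) * (2 * nbRad (d + 1) L + 1) ^ (d + 1)))
            / ((L : ℝ) / (L : ℝ) ^ (d + 1))))) * ((L : ℝ) ^ (k + 1) * α₀) ≤ 1)
    (hb : 256 * (((d + 1 : ℕ) : ℝ) + 1) * L * (3 + 12 * ((d + 1 : ℕ) : ℝ)) * ((L : ℝ) ^ (k + 1) * α₀) ≤ 1)
    (hflatTop : cavgIter L (k + 1) (vary (flat (d := d + 1) (n := n)) A 1) = flat)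
    {KG : ℝ}
    (hG : ∀ X : Site (d + 1) → Fin (d + 1) → Matrix n n ℂ, IsSkewDir X → IsPeriodicDir X ((L ^ (k + 1) * N : ℕ) : ℤ) →
      dirIter L (k + 1) (flat (d := d + 1) (n := n)) X = 0 → ∀ g : ℝ, 0 ≤ g →
      (∀ Y : Site (d + 1) → Fin (d + 1) → Matrix n n ℂ, IsSkewDir Y → IsPeriodicDir Y ((L ^ (k + 1) * N : ℕ) : ℤ) →
        dirIter L (k + 1) (flat (d := d + 1) (n := n)) Y = 0 →
        |hess (flat (d := d + 1) (n := n)) X Y (perWin (d + 1) (L ^ (k + 1) * N))| ≤ g * dirL1 Y (periodBox (d := d + 1) (L ^ (k + 1) * N))) →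
      ∀ (z : Site (d + 1)) (μ ν : Fin (d + 1)), μ ≠ ν → ‖curlAt (flat (d := d + 1) (n := n)) X z μ ν‖ ≤ KG * g) :
    SmallField U
      (KG * (((a * ((curl1C (d + 1) L / (1 - thetaLoc (d + 1) L * (((L : ℝ) ^ (k + 1)) ^ 2 * x)))
                  * (((L : ℝ) ^ (k + 1)) ^ (d + 1) / ((L : ℝ) ^ (k + 1)) ^ 2)))
              * (2 * ((8 * (3 + 12 * ((d + 1 : ℕ) : ℝ)) * (2 + 2 * ((((d + 1 : ℕ) : ℝ) + 1) * L)
                  * (1 + ((1250 * ((nbRad (d + 1) L : ℝ) + L) + 8 * (((d + 1 : ℕ) : ℝ) * L) + 2 * L)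
                      * (((d + 1 : ℕ) : ℝ) * (2 * nbRad (d + 1) L + 1) ^ (d + 1))) / ((L : ℝ) / (L : ℝ) ^ (d + 1))))) * ((L : ℝ) ^ (k + 1) * α₀))
                * ((L : ℝ) / (L : ℝ) ^ (d + 1)) ^ (k + 1)))
            + (Fintype.card (T4AveragingDeficitWall.Plane (d + 1)) : ℝ)
              * (2 * (8 * α₀ * (2 * α₁ + 28 * α₀ ^ 2) + 6 * (Real.exp α₀ - 1) * (2 * α₁ + 24 * (Real.exp α₀ - 1) * α₀)
                  + (2 * α₁ + 24 * (Real.exp α₀ - 1) * α₀) * (2 * α₁ + 28 * α₀ ^ 2) + 960 * (Real.exp α₀ - 1) * α₀ ^ 2)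
                + 64 * α₀ * α₁))
        + Fintype.card n * ((2 * (CdecD d * (((d : ℝ) + 1) * (2 * ((d : ℝ) + 1))
              * ((2 + 32 / (kappa163 (d + 1) / (d + 1)) ^ 2) * latticeConst (d + 1) (kappa163 (d + 1) / (d + 1) / 2)))))
              / ((L ^ (k + 1) : ℕ) : ℝ)
            * ((0 + 28 * ((3 + 12 * ((d + 1 : ℕ) : ℝ)) * ((L : ℝ) ^ (k + 1) * α₀)
                    + 4 * (3 + 12 * ((d + 1 : ℕ) : ℝ)) ^ 3 / rho0 (d + 1) L ^ 2 * ((L : ℝ) ^ (k + 1) * α₀) ^ 2) ^ 2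
                  + 4 * (4 * (3 + 12 * ((d + 1 : ℕ) : ℝ)) ^ 3 / rho0 (d + 1) L ^ 2 * ((L : ℝ) ^ (k + 1) * α₀) ^ 2))
                / ((L ^ (k + 1) : ℕ) : ℝ)))
        + 28 * α₀ ^ 2) := by
  have hcurv : curvSum (d + 1) L (k + 1) 0 ≤ 2 / 3 * L := by rw [curvSum_zero]; positivity
  have hΛ : ∀ Y : Site (d + 1) → Fin (d + 1) → Matrix n n ℂ, IsSkewDir Y → IsPeriodicDir Y ((L ^ (k + 1) * N : ℕ) : ℤ) →
      ∑ z ∈ periodBox N, ∑ κ : Fin (d + 1), ‖QbarIter L (k + 1) (vary (flat (d := d + 1) (n := n)) A 1) Y z κ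
          - QbarIter L (k + 1) (flat (d := d + 1) (n := n)) Y z κ‖
        ≤ (2 * ((8 * (3 + 12 * ((d + 1 : ℕ) : ℝ)) * (2 + 2 * ((((d + 1 : ℕ) : ℝ) + 1) * L)
                * (1 + ((1250 * ((nbRad (d + 1) L : ℝ) + L) + 8 * (((d + 1 : ℕ) : ℝ) * L) + 2 * L)
                    * (((d + 1 : ℕ) : ℝ) * (2 * nbRad (d + 1) L + 1) ^ (d + 1))) / ((L : ℝ) / (L : ℝ) ^ (d + 1))))) * ((L : ℝ) ^ (k + 1) * α₀))
              * ((L : ℝ) / (L : ℝ) ^ (d + 1)) ^ (k + 1))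
          * dirL1 Y (periodBox (d := d + 1) (L ^ (k + 1) * N)) := fun Y _ hYP => by
    simpa only [mul_assoc] using sum_norm_QbarIter_vary_flat_sub_le (n := n) hL (levelSmall_zero L (k + 1)) hcurv hA hAP hα₀ hAα hσ hS1 hb Y hYP
  have hΛ0 : 0 ≤ 2 * ((8 * (3 + 12 * ((d + 1 : ℕ) : ℝ)) * (2 + 2 * ((((d + 1 : ℕ) : ℝ) + 1) * L)
                * (1 + ((1250 * ((nbRad (d + 1) L : ℝ) + L) + 8 * (((d + 1 : ℕ) : ℝ) * L) + 2 * L)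
                    * (((d + 1 : ℕ) : ℝ) * (2 * nbRad (d + 1) L + 1) ^ (d + 1))) / ((L : ℝ) / (L : ℝ) ^ (d + 1))))) * ((L : ℝ) ^ (k + 1) * α₀))
              * ((L : ℝ) / (L : ℝ) ^ (d + 1)) ^ (k + 1) := by positivity
  exact smallField_of_trivialLetters_gauge_skew hL k hU hx hs hUx ha hUa hcritU hu huP hgauge hA hAP hα₀ hα₁ hAα hA1 hθ hθl hε hσ hflatTop hΛ0 hΛ hG

/-- **THE END IN F31's CURRENCY, `G♭` ON THE SKEW SLICE** (`M = L^{k+1}`): at the plaquette radius `a = δM⁻²`, with the solver constant `K_G = K·M` (asked on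
skew periodic tangent `X` only), the sup currency `α̂ := Mα₀` and a gradient currency `α₁ ≤ α̂₁M⁻²`, the radius of `smallField_of_trivialLetters_explicit_skew` is
`≤ (K(τ̂ + ρ̂) + C_Rĝ + 28α̂²)·M⁻²` with `τ̂ = 2·(curl1C∕(1−θℓ))·C_S·δ·α̂` (F54a `tau_currency_delta`), `ρ̂ = #Plane·(144α̂α̂₁ + 5440α̂³ + 8α̂₁² + 304α̂₁α̂² + 2688α̂⁴)`
(F48b `rho_currency`), `C_Rĝ = card n·C₃₇·ĝ(α̂)` (F37 × F43) — F38 `radius_currency`; EVERY `M` CANCELS; radius LITERALLY F54b's. [folklore] -/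
theorem smallField_of_trivialLetters_currency_skew [Nonempty n] {L N : ℕ} [NeZero N] (hL : 2 ≤ L) (k : ℕ)
    {U : Site (d + 1) → Fin (d + 1) → (Matrix n n ℂ)ˣ} (hU : IsUnitaryCfg U) {x δ : ℝ} (hx : 0 ≤ x) (hs : LevelSmall (d + 1) L k x)
    (hUx : SmallField U x) (hδ : 0 ≤ δ) (hUδ : SmallField U (δ / ((L : ℝ) ^ (k + 1)) ^ 2))
    (hcritU : ∀ φ : Site (d + 1) → Fin (d + 1) → Matrix n n ℂ, IsSkewDir φ → IsPeriodicDir φ ((L ^ (k + 1) * N : ℕ) : ℤ) →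
      dirIter L (k + 1) U φ = 0 → dAction U φ (perWin (d + 1) (L ^ (k + 1) * N)) = 0)
    {u : Site (d + 1) → (Matrix n n ℂ)ˣ} (hu : IsUnitarySite u) (huP : ∀ (y : Site (d + 1)) (i : Fin (d + 1)), u (y + (((L ^ (k + 1) * N : ℕ) : ℤ)) • e i) = u y)
    {A : Site (d + 1) → Fin (d + 1) → Matrix n n ℂ} (hgauge : gaugeAct u U = vary (flat (d := d + 1) (n := n)) A 1)
    (hA : IsSkewDir A) (hAP : IsPeriodicDir A ((L ^ (k + 1) * N : ℕ) : ℤ))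
    {α₀ α₁ αh1 : ℝ} (hα₀ : 0 ≤ α₀) (hα₁ : 0 ≤ α₁) (hAα : ∀ (y : Site (d + 1)) (κ : Fin (d + 1)), ‖A y κ‖ ≤ α₀)
    (hA1 : ∀ (y : Site (d + 1)) (κ τ : Fin (d + 1)), ‖A (y + e τ) κ - A y κ‖ ≤ α₁) (hα₁h : α₁ ≤ αh1 / ((L : ℝ) ^ (k + 1)) ^ 2)
    (hθ : cruxC (d + 1) L * (((L : ℝ) ^ (k + 1)) ^ 2 * x) < 1) (hθl : thetaLoc (d + 1) L * (((L : ℝ) ^ (k + 1)) ^ 2 * x) < 1)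
    (hε : ((L : ℝ) ^ (k + 1)) ^ 2 * x ≤ 1)
    (hσ : 4 * (3 + 12 * ((d + 1 : ℕ) : ℝ)) ^ 2 * (L : ℝ) ^ (k + 1) * α₀ ≤ rho0 (d + 1) L ^ 2)
    (hS1 : (8 * (3 + 12 * ((d + 1 : ℕ) : ℝ)) * (2 + 2 * ((((d + 1 : ℕ) : ℝ) + 1) * L)
        * (1 + ((1250 * ((nbRad (d + 1) L : ℝ) + L) + 8 * (((d + 1 : ℕ) : ℝ) * L) + 2 * L) * (((d + 1 : ℕ) : ℝ) * (2 * nbRad (d + 1) L + 1) ^ (d + 1)))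
            / ((L : ℝ) / (L : ℝ) ^ (d + 1))))) * ((L : ℝ) ^ (k + 1) * α₀) ≤ 1)
    (hb : 256 * (((d + 1 : ℕ) : ℝ) + 1) * L * (3 + 12 * ((d + 1 : ℕ) : ℝ)) * ((L : ℝ) ^ (k + 1) * α₀) ≤ 1)
    (hflatTop : cavgIter L (k + 1) (vary (flat (d := d + 1) (n := n)) A 1) = flat)
    {K : ℝ} (hK : 0 ≤ K)
    (hG : ∀ X : Site (d + 1) → Fin (d + 1) → Matrix n n ℂ, IsSkewDir X → IsPeriodicDir X ((L ^ (k + 1) * N : ℕ) : ℤ) →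
      dirIter L (k + 1) (flat (d := d + 1) (n := n)) X = 0 → ∀ g : ℝ, 0 ≤ g →
      (∀ Y : Site (d + 1) → Fin (d + 1) → Matrix n n ℂ, IsSkewDir Y → IsPeriodicDir Y ((L ^ (k + 1) * N : ℕ) : ℤ) →
        dirIter L (k + 1) (flat (d := d + 1) (n := n)) Y = 0 →
        |hess (flat (d := d + 1) (n := n)) X Y (perWin (d + 1) (L ^ (k + 1) * N))| ≤ g * dirL1 Y (periodBox (d := d + 1) (L ^ (k + 1) * N))) →
      ∀ (z : Site (d + 1)) (μ ν : Fin (d + 1)), μ ≠ ν → ‖curlAt (flat (d := d + 1) (n := n)) X z μ ν‖ ≤ K * (L : ℝ) ^ (k + 1) * g) :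
    SmallField U
      ((K * (2 * (curl1C (d + 1) L / (1 - thetaLoc (d + 1) L * (((L : ℝ) ^ (k + 1)) ^ 2 * x)))
                * (8 * (3 + 12 * ((d + 1 : ℕ) : ℝ)) * (2 + 2 * ((((d + 1 : ℕ) : ℝ) + 1) * L)
                  * (1 + ((1250 * ((nbRad (d + 1) L : ℝ) + L) + 8 * (((d + 1 : ℕ) : ℝ) * L) + 2 * L)
                      * (((d + 1 : ℕ) : ℝ) * (2 * nbRad (d + 1) L + 1) ^ (d + 1))) / ((L : ℝ) / (L : ℝ) ^ (d + 1)))))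
                * δ * ((L : ℝ) ^ (k + 1) * α₀)
              + (Fintype.card (T4AveragingDeficitWall.Plane (d + 1)) : ℝ)
                * (144 * (((L : ℝ) ^ (k + 1) * α₀) * αh1) + 5440 * ((L : ℝ) ^ (k + 1) * α₀) ^ 3 + 8 * (αh1 * αh1)
                    + 304 * (αh1 * ((L : ℝ) ^ (k + 1) * α₀) ^ 2) + 2688 * ((L : ℝ) ^ (k + 1) * α₀) ^ 4))
          + Fintype.card n * (2 * (CdecD d * (((d : ℝ) + 1) * (2 * ((d : ℝ) + 1))
              * ((2 + 32 / (kappa163 (d + 1) / (d + 1)) ^ 2) * latticeConst (d + 1) (kappa163 (d + 1) / (d + 1) / 2)))))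
            * (0 + 28 * ((3 + 12 * ((d + 1 : ℕ) : ℝ)) * ((L : ℝ) ^ (k + 1) * α₀)
                  + 4 * (3 + 12 * ((d + 1 : ℕ) : ℝ)) ^ 3 / rho0 (d + 1) L ^ 2 * ((L : ℝ) ^ (k + 1) * α₀) ^ 2) ^ 2
                + 4 * (4 * (3 + 12 * ((d + 1 : ℕ) : ℝ)) ^ 3 / rho0 (d + 1) L ^ 2 * ((L : ℝ) ^ (k + 1) * α₀) ^ 2))
          + 28 * ((L : ℝ) ^ (k + 1) * α₀) ^ 2)
        / ((L : ℝ) ^ (k + 1)) ^ 2) := by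
  have hL1 : 1 ≤ L := by omega
  have hLr : (1 : ℝ) ≤ L := by exact_mod_cast hL1
  have hM1 : (1 : ℝ) ≤ (L : ℝ) ^ (k + 1) := one_le_pow₀ hLr
  have hM : (0 : ℝ) < (L : ℝ) ^ (k + 1) := by linarith
  have ha : 0 ≤ δ / ((L : ℝ) ^ (k + 1)) ^ 2 := by positivity
  have h := smallField_of_trivialLetters_explicit_skew hL k hU hx hs hUx ha hUδ hcritU hu huP hgauge hA hAP hα₀ hα₁ hAα hA1 hθ hθl hε hσ hS1 hb
    hflatTop (KG := K * (L : ℝ) ^ (k + 1)) hG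
  have hpos : 0 < 1 - thetaLoc (d + 1) L * (((L : ℝ) ^ (k + 1)) ^ 2 * x) := by linarith
  have hC0 := curl1C_nonneg (d + 1) L
  have hτh := (tau_currency_delta hL1 k (d + 1) δ (curl1C (d + 1) L / (1 - thetaLoc (d + 1) L * (((L : ℝ) ^ (k + 1)) ^ 2 * x)))
    (8 * (3 + 12 * ((d + 1 : ℕ) : ℝ)) * (2 + 2 * ((((d + 1 : ℕ) : ℝ) + 1) * L)
      * (1 + ((1250 * ((nbRad (d + 1) L : ℝ) + L) + 8 * (((d + 1 : ℕ) : ℝ) * L) + 2 * L)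
          * (((d + 1 : ℕ) : ℝ) * (2 * nbRad (d + 1) L + 1) ^ (d + 1))) / ((L : ℝ) / (L : ℝ) ^ (d + 1)))))
    ((L : ℝ) ^ (k + 1) * α₀)).le
  have hαh1' : (L : ℝ) ^ (k + 1) * α₀ ≤ 1 := by
    have hd : (0 : ℝ) ≤ ((d + 1 : ℕ) : ℝ) := by positivity
    have h1 : (1 : ℝ) ≤ 256 * (((d + 1 : ℕ) : ℝ) + 1) * L * (3 + 12 * ((d + 1 : ℕ) : ℝ)) := by nlinarith
    nlinarith [show 0 ≤ (L : ℝ) ^ (k + 1) * α₀ by positivity]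
  have hα₀h : α₀ ≤ (L : ℝ) ^ (k + 1) * α₀ / (L : ℝ) ^ (k + 1) := by rw [le_div_iff₀ hM, mul_comm]
  have hρh := rho_currency (cP := (Fintype.card (T4AveragingDeficitWall.Plane (d + 1)) : ℝ)) hM1 hα₀ hα₀h hα₁ hα₁h hαh1' (by positivity)
  have hcast : ((L ^ (k + 1) : ℕ) : ℝ) = (L : ℝ) ^ (k + 1) := by push_cast; ring
  have hcN : Fintype.card n * ((2 * (CdecD d * (((d : ℝ) + 1) * (2 * ((d : ℝ) + 1))
              * ((2 + 32 / (kappa163 (d + 1) / (d + 1)) ^ 2) * latticeConst (d + 1) (kappa163 (d + 1) / (d + 1) / 2)))))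
              / ((L ^ (k + 1) : ℕ) : ℝ)
            * ((0 + 28 * ((3 + 12 * ((d + 1 : ℕ) : ℝ)) * ((L : ℝ) ^ (k + 1) * α₀)
                    + 4 * (3 + 12 * ((d + 1 : ℕ) : ℝ)) ^ 3 / rho0 (d + 1) L ^ 2 * ((L : ℝ) ^ (k + 1) * α₀) ^ 2) ^ 2
                  + 4 * (4 * (3 + 12 * ((d + 1 : ℕ) : ℝ)) ^ 3 / rho0 (d + 1) L ^ 2 * ((L : ℝ) ^ (k + 1) * α₀) ^ 2))
                / ((L ^ (k + 1) : ℕ) : ℝ)))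
      ≤ Fintype.card n * (2 * (CdecD d * (((d : ℝ) + 1) * (2 * ((d : ℝ) + 1))
              * ((2 + 32 / (kappa163 (d + 1) / (d + 1)) ^ 2) * latticeConst (d + 1) (kappa163 (d + 1) / (d + 1) / 2)))))
            * (0 + 28 * ((3 + 12 * ((d + 1 : ℕ) : ℝ)) * ((L : ℝ) ^ (k + 1) * α₀)
                  + 4 * (3 + 12 * ((d + 1 : ℕ) : ℝ)) ^ 3 / rho0 (d + 1) L ^ 2 * ((L : ℝ) ^ (k + 1) * α₀) ^ 2) ^ 2
                + 4 * (4 * (3 + 12 * ((d + 1 : ℕ) : ℝ)) ^ 3 / rho0 (d + 1) L ^ 2 * ((L : ℝ) ^ (k + 1) * α₀) ^ 2))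
          / ((L : ℝ) ^ (k + 1)) ^ 2 := by
    rw [hcast]; apply le_of_eq; field_simp
  exact SmallField.mono h (radius_currency (K := K) hM hK rfl hτh hρh hcN hα₀ hα₀h)

end

end Summit.QuantumFields.BalabanUV.T4Continuum.NE7ApeTrivialFlatEndSkewBudget
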